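import Literature.NumberTheory.LFunctions.LiouvilleWalshAssembly
import Literature.NumberTheory.LFunctions.LiouvilleWalshTypeIIZeroClean
import HarnessLib

/-!
# Bourgain 2013, Theorem 1 for `λ`: the two windows of the type-II hypothesis combined — proved

Topic `Literature/NumberTheory/LFunctions`, proofs companion of `MoebiusWalshCircuits.lean`
(named fact `bourgain_liouville_walsh_uniform`: J. Bourgain, *Möbius–Walsh correlation bounds and
an estimate of Mauduit and Rivat*, J. Anal. Math. **119** (2013) 147–163 = arXiv:1109.2784
[Bourgain2013MoebiusWalsh], Theorem 1 with its parenthesis "(a similar estimate is also valid for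
the Liouville function)"). Everything here is PROVED (theorems only; no definition, no named fact,
nothing discharged).

The synthesis `LiouvilleWalsh.bourgain_liouville_walsh_uniform_of_typeII`
(`LiouvilleWalshAssembly.lean`) reduces the fact to ONE per-box type-II hypothesis `hII`
(Bourgain's (2.28)–(2.29) in the three-savings form
`(i+j+2)^C 2^{i+j} (2^{-cρ} + 2^{Cρ-ci} + 2^{Cρ-c|T ∩ [K,K+i)|})`) quantified over the ADMISSIBLE
window origins `K = 0 ∨ (i ≤ K + ρ ∧ 4ρ < K)`. The §2 analysis delivers it in two halves with
their own constants: the bottom window `K = 0` ((2.13)–(2.22); in the tree, PROVED: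
`LiouvilleWalsh.typeII_clean_zero`, file `LiouvilleWalshTypeIIZeroClean.lean`) and the shifted
windows `K > 4ρ` ((2.23)–(2.28) with Lemma 5). This file is the bookkeeping that joins them:

* `threeSavings_mono` — the majorant is monotone under `c ↦ c' ≤ c`, `C ↦ C' ≥ C`;
* `hII_of_halves` — from the two halves (each `∃ c > 0, ∃ C ≥ 1, …`) the full hypothesis `hII`
  with `c = min(c₀, c₁)`, `C = max(C₀, C₁)`;
* `hII_of_high` — the same with the bottom half supplied by the tree's `typeII_clean_zero`;
* `bourgain_liouville_walsh_uniform_of_high` — **Theorem 1 for `λ` from the shifted-window half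
  alone**: the remaining input is exactly the statement
  `∃ c > 0, ∃ C ≥ 1, ∀ T i j ρ K β, i ≤ j → 1 ≤ ρ → i ≤ K + ρ → 4ρ < K → K + ρ ≤ j → |β| ≤ 1 →`
  `∑_{a ∈ D_i} |∑_{b ∈ D_j} β(b) w_T(ab)| ≤ (i+j+2)^C 2^{i+j} (2^{-cρ} + 2^{Cρ-ci} + 2^{Cρ-c|T ∩ [K,K+i)|})`
  (Bourgain (2.28) for `K ≥ μ - ρ`), taken as a hypothesis here.

## References

* J. Bourgain, J. Anal. Math. 119 (2013) 147–163; arXiv:1109.2784: Theorem 1 (remark on `λ`),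
  §2 (2.22), (2.28)–(2.29). [Bourgain2013MoebiusWalsh]
-/

noncomputable section

open Finset Real Filter

namespace Literature.NumberTheory.LFunctions.LiouvilleWalsh

open Literature.NumberTheory.LFunctions.MoebiusWalshVaughan (natWalsh dyBlock)

/-- **Monotonicity of the three-savings majorant in its constants**: shrinking `c` and enlarging
`C` only increases `(i+j+2)^C 2^{i+j} (2^{-cρ} + 2^{Cρ-ci} + 2^{Cρ-cw})` (`w ≥ 0`). [folklore] -/
theorem threeSavings_mono {c c' C C' : ℝ} (hcc : c' ≤ c) (hC : 1 ≤ C)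
    (hCC : C ≤ C') (i j ρ : ℕ) {w : ℝ} (hw : 0 ≤ w) :
    ((i : ℝ) + j + 2) ^ C * 2 ^ (i + j) *
        ((2 : ℝ) ^ (-(c * ρ)) + (2 : ℝ) ^ (C * ρ - c * i) + (2 : ℝ) ^ (C * ρ - c * w)) ≤
      ((i : ℝ) + j + 2) ^ C' * 2 ^ (i + j) *
        ((2 : ℝ) ^ (-(c' * ρ)) + (2 : ℝ) ^ (C' * ρ - c' * i) + (2 : ℝ) ^ (C' * ρ - c' * w)) := by
  have hρ : (0 : ℝ) ≤ ρ := Nat.cast_nonneg _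
  have hi : (0 : ℝ) ≤ i := Nat.cast_nonneg _
  have hL : (1 : ℝ) ≤ (i : ℝ) + j + 2 := by
    have : (0 : ℝ) ≤ (i : ℝ) + j := by positivity
    linarith
  have h2 : (1 : ℝ) ≤ 2 := by norm_num
  have hC0 : 0 ≤ C := by linarith
  have e1 : -(c * (ρ : ℝ)) ≤ -(c' * ρ) := by nlinarith
  have e2 : C * (ρ : ℝ) - c * i ≤ C' * ρ - c' * i := by nlinarith
  have e3 : C * (ρ : ℝ) - c * w ≤ C' * ρ - c' * w := by nlinarith
  have f0 : ((i : ℝ) + j + 2) ^ C ≤ ((i : ℝ) + j + 2) ^ C' :=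
    Real.rpow_le_rpow_of_exponent_le hL hCC
  have f1 : (2 : ℝ) ^ (-(c * (ρ : ℝ))) ≤ (2 : ℝ) ^ (-(c' * (ρ : ℝ))) :=
    Real.rpow_le_rpow_of_exponent_le h2 e1
  have f2 : (2 : ℝ) ^ (C * (ρ : ℝ) - c * i) ≤ (2 : ℝ) ^ (C' * (ρ : ℝ) - c' * i) :=
    Real.rpow_le_rpow_of_exponent_le h2 e2
  have f3 : (2 : ℝ) ^ (C * (ρ : ℝ) - c * w) ≤ (2 : ℝ) ^ (C' * (ρ : ℝ) - c' * w) :=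
    Real.rpow_le_rpow_of_exponent_le h2 e3
  have g0 : (0 : ℝ) ≤ ((i : ℝ) + j + 2) ^ C := Real.rpow_nonneg (by linarith) _
  have g1 : (0 : ℝ) ≤ (2 : ℝ) ^ (i + j) := by positivity
  have gs : (0 : ℝ) ≤ (2 : ℝ) ^ (-(c * (ρ : ℝ))) + (2 : ℝ) ^ (C * (ρ : ℝ) - c * i) +
      (2 : ℝ) ^ (C * (ρ : ℝ) - c * w) := by positivity
  calc ((i : ℝ) + j + 2) ^ C * 2 ^ (i + j) *
        ((2 : ℝ) ^ (-(c * ρ)) + (2 : ℝ) ^ (C * ρ - c * i) + (2 : ℝ) ^ (C * ρ - c * w))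
      ≤ ((i : ℝ) + j + 2) ^ C' * 2 ^ (i + j) *
        ((2 : ℝ) ^ (-(c * ρ)) + (2 : ℝ) ^ (C * ρ - c * i) + (2 : ℝ) ^ (C * ρ - c * w)) := by
        apply mul_le_mul_of_nonneg_right _ gs
        exact mul_le_mul_of_nonneg_right f0 g1
    _ ≤ ((i : ℝ) + j + 2) ^ C' * 2 ^ (i + j) *
        ((2 : ℝ) ^ (-(c' * ρ)) + (2 : ℝ) ^ (C' * ρ - c' * i) + (2 : ℝ) ^ (C' * ρ - c' * w)) := by
        apply mul_le_mul_of_nonneg_left _ (mul_nonneg (Real.rpow_nonneg (by linarith) _) g1)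
        exact add_le_add (add_le_add f1 f2) f3

/-- **The per-box type-II hypothesis from its two windows.** If the three-savings bound holds
for the bottom window `K = 0` (constants `c₀, C₀`; `ρ ≤ j`) and for the shifted windows
`i ≤ K + ρ`, `4ρ < K`, `K + ρ ≤ j` (constants `c₁, C₁`), then it holds for all admissible
`K = 0 ∨ (i ≤ K + ρ ∧ 4ρ < K)`, `K + ρ ≤ j`, with `c = min(c₀,c₁)`, `C = max(C₀,C₁)` — the
hypothesis `hII` of `bourgain_liouville_walsh_uniform_of_typeII`.
[cite: Bourgain2013MoebiusWalsh, §2 (2.22), (2.28)–(2.29)] -/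
theorem hII_of_halves
    (h0 : ∃ c : ℝ, 0 < c ∧ ∃ C : ℝ, 1 ≤ C ∧
      ∀ (T : Finset ℕ) (i j ρ : ℕ) (β : ℕ → ℝ), i ≤ j → 1 ≤ ρ → ρ ≤ j → (∀ b, |β b| ≤ 1) →
        ∑ a ∈ dyBlock i, |∑ b ∈ dyBlock j, β b * natWalsh T (a * b)| ≤
          ((i : ℝ) + j + 2) ^ C * 2 ^ (i + j) *
            ((2 : ℝ) ^ (-(c * ρ)) + (2 : ℝ) ^ (C * ρ - c * i) +
              (2 : ℝ) ^ (C * ρ - c * ((T.filter fun t => 0 ≤ t ∧ t < 0 + i).card : ℝ))))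
    (h1 : ∃ c : ℝ, 0 < c ∧ ∃ C : ℝ, 1 ≤ C ∧
      ∀ (T : Finset ℕ) (i j ρ K : ℕ) (β : ℕ → ℝ), i ≤ j → 1 ≤ ρ → i ≤ K + ρ → 4 * ρ < K →
        K + ρ ≤ j → (∀ b, |β b| ≤ 1) →
        ∑ a ∈ dyBlock i, |∑ b ∈ dyBlock j, β b * natWalsh T (a * b)| ≤
          ((i : ℝ) + j + 2) ^ C * 2 ^ (i + j) *
            ((2 : ℝ) ^ (-(c * ρ)) + (2 : ℝ) ^ (C * ρ - c * i) +
              (2 : ℝ) ^ (C * ρ - c * ((T.filter fun t => K ≤ t ∧ t < K + i).card : ℝ)))) :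
    ∃ c : ℝ, 0 < c ∧ ∃ C : ℝ, 1 ≤ C ∧
      ∀ (T : Finset ℕ) (i j ρ K : ℕ) (β : ℕ → ℝ), i ≤ j → 1 ≤ ρ →
        (K = 0 ∨ (i ≤ K + ρ ∧ 4 * ρ < K)) → K + ρ ≤ j → (∀ b, |β b| ≤ 1) →
        ∑ a ∈ dyBlock i, |∑ b ∈ dyBlock j, β b * natWalsh T (a * b)| ≤
          ((i : ℝ) + j + 2) ^ C * 2 ^ (i + j) *
            ((2 : ℝ) ^ (-(c * ρ)) + (2 : ℝ) ^ (C * ρ - c * i) +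
              (2 : ℝ) ^ (C * ρ - c * ((T.filter fun t => K ≤ t ∧ t < K + i).card : ℝ))) := by
  obtain ⟨c₀, hc₀, C₀, hC₀, h0⟩ := h0
  obtain ⟨c₁, hc₁, C₁, hC₁, h1⟩ := h1
  refine ⟨min c₀ c₁, lt_min hc₀ hc₁, max C₀ C₁, le_max_of_le_left hC₀, ?_⟩
  intro T i j ρ K β hij hρ hK hKj hβ
  rcases hK with rfl | ⟨hiK, h4⟩
  · have hρj : ρ ≤ j := by simpa using hKj
    exact (h0 T i j ρ β hij hρ hρj hβ).trans
      (threeSavings_mono (min_le_left _ _) hC₀ (le_max_left _ _) i j ρ (Nat.cast_nonneg _))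
  · exact (h1 T i j ρ K β hij hρ hiK h4 hKj hβ).trans
      (threeSavings_mono (min_le_right _ _) hC₁ (le_max_right _ _) i j ρ (Nat.cast_nonneg _))

/-- **The per-box type-II hypothesis from its shifted-window half**, the bottom window being the
tree's `typeII_clean_zero`. [cite: Bourgain2013MoebiusWalsh, §2 (2.22), (2.28)–(2.29)] -/
theorem hII_of_high
    (h1 : ∃ c : ℝ, 0 < c ∧ ∃ C : ℝ, 1 ≤ C ∧
      ∀ (T : Finset ℕ) (i j ρ K : ℕ) (β : ℕ → ℝ), i ≤ j → 1 ≤ ρ → i ≤ K + ρ → 4 * ρ < K →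
        K + ρ ≤ j → (∀ b, |β b| ≤ 1) →
        ∑ a ∈ dyBlock i, |∑ b ∈ dyBlock j, β b * natWalsh T (a * b)| ≤
          ((i : ℝ) + j + 2) ^ C * 2 ^ (i + j) *
            ((2 : ℝ) ^ (-(c * ρ)) + (2 : ℝ) ^ (C * ρ - c * i) +
              (2 : ℝ) ^ (C * ρ - c * ((T.filter fun t => K ≤ t ∧ t < K + i).card : ℝ)))) :
    ∃ c : ℝ, 0 < c ∧ ∃ C : ℝ, 1 ≤ C ∧
      ∀ (T : Finset ℕ) (i j ρ K : ℕ) (β : ℕ → ℝ), i ≤ j → 1 ≤ ρ →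
        (K = 0 ∨ (i ≤ K + ρ ∧ 4 * ρ < K)) → K + ρ ≤ j → (∀ b, |β b| ≤ 1) →
        ∑ a ∈ dyBlock i, |∑ b ∈ dyBlock j, β b * natWalsh T (a * b)| ≤
          ((i : ℝ) + j + 2) ^ C * 2 ^ (i + j) *
            ((2 : ℝ) ^ (-(c * ρ)) + (2 : ℝ) ^ (C * ρ - c * i) +
              (2 : ℝ) ^ (C * ρ - c * ((T.filter fun t => K ≤ t ∧ t < K + i).card : ℝ))) :=
  hII_of_halves typeII_clean_zero h1

/-- **Bourgain 2013, Theorem 1 for the Liouville function, from the shifted-window type-II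
estimate alone.** Given Bourgain's (2.28) for the windows `K ≥ μ - ρ` in the three-savings
per-box form (the hypothesis; the bottom window `K = 0` (2.22), the type-I bounds of §3, Green's
small-weight estimate and the synthesis (2.29)–(3.10) are theorems of the tree), for all large `n`
and every `A ⊆ {0,…,n-1}`: `|∑_{x<2ⁿ} λ(x) w_A(x)| < 2^{n - n^{1/10}}`.
[cite: Bourgain2013MoebiusWalsh, Theorem 1 (remark on λ), §2 (2.28)–(2.29)] -/
theorem bourgain_liouville_walsh_uniform_of_high
    (h1 : ∃ c : ℝ, 0 < c ∧ ∃ C : ℝ, 1 ≤ C ∧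
      ∀ (T : Finset ℕ) (i j ρ K : ℕ) (β : ℕ → ℝ), i ≤ j → 1 ≤ ρ → i ≤ K + ρ → 4 * ρ < K →
        K + ρ ≤ j → (∀ b, |β b| ≤ 1) →
        ∑ a ∈ dyBlock i, |∑ b ∈ dyBlock j, β b * natWalsh T (a * b)| ≤
          ((i : ℝ) + j + 2) ^ C * 2 ^ (i + j) *
            ((2 : ℝ) ^ (-(c * ρ)) + (2 : ℝ) ^ (C * ρ - c * i) +
              (2 : ℝ) ^ (C * ρ - c * ((T.filter fun t => K ≤ t ∧ t < K + i).card : ℝ)))) :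
    bourgain_liouville_walsh_uniform :=
  bourgain_liouville_walsh_uniform_of_typeII (hII_of_high h1)

end Literature.NumberTheory.LFunctions.LiouvilleWalsh
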